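import Summits.HubbardSuperconductivity.HubbardSuperconductivity.Theorems.WeakCouplingBCSKlHarmonicDual

/-!
# Harmonic-dual cell targets v2 at `(δ, t′) = (⅛, −3/10)` — ADD-ON to `Theorems/WeakCouplingBCSKlHarmonicDual.lean` (statements only)

Reader seat hubbard-klscan-idea-3 (lens dual), round 9: the reader card r8's located §4 targets RETARGETED after klscan-crit-1's S1 (KL STATUS
l.10391): Friedel amplitude `1/20 ↦ 1/12` beyond shell `16`, block radius `24 ↦ 40`, trace constant `12` and truncated gap `1/5` kept; recomputed
margin `11/205`.  HONEST FRAMING: three `Prop` definitions and one bookkeeping theorem over the instrument file's §2–§3; NOTHING is asserted — no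
margin at this or any `t′ ≠ 0` cell, nothing about `K₃`, `U₀`, the onset window or superconductivity; a Kohn–Luttinger `O(U²)` channel statement is
not ODLRO.  This file elaborates only after the instrument file (queue item (14)) is in the tree; its §4 block is byte-identical to §4 of the
reader's `r8/Sketch8-v2.lean` (farm-checked as one file).
-/

noncomputable section

-- the tree's namespace convention repeats the summit name by design (D-0017)
set_option linter.dupNamespace false

open Set MeasureTheory
open Literature.MathematicalPhysics.QuantumLattice
open Summit.HubbardSuperconductivity.HubbardSuperconductivity.Theorems
open Summit.HubbardSuperconductivity.HubbardSuperconductivity.Theorems.CwKLChiralWindow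

namespace Summit.HubbardSuperconductivity.HubbardSuperconductivity.Theorems.KlHarmonicDual

/-! ## §4 (v2, retargeted after klscan-crit-1 S1, STATUS l.10391)  Located targets at the granted cell `(δ, t′) = (⅛, −3/10)`

Statements only; nothing is claimed.  RETARGET of the reader card's §4: the v1 Friedel amplitude `1/20` beyond shell `16` is float-contradicted
(shell sup-amplitudes `0.047–0.057` at `17 ≤ |R|_∞ ≤ 22` by the card's own `L = 96` coefficients and by crit-1's independent brute force; `0.046–0.050`
for `12 ≤ s ≤ 30` under the finer `L = 160`, `ns = 36`, `Nx = 256` quadrature of FARFIELD-I) ⇒ v2 asserts `A = 1/12` (head-room `× 1.2–1.8` over every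
resolved float) beyond the same shell `16`, keeps the trace constant `C = 12` (crit-1: `F(s)/(s+1) ≤ 11.04` for `s ≤ 34`; conjectured sharp law
`F(s) = (2π/m)(2s+1) + o(s)`, `2π/m = 5.16` here), moves the block radius to `R₀ = 40` (`≈ 820` coefficients with `|R|_∞ ≤ 40` up to the symmetries)
and keeps the truncated gap `1/5` (floats `0.237`, flat in `R₀`); the recomputed cell margin is `1/5 − 2·(3·12·(1/12))/41 = 11/205 ≈ 0.0537` at `U = 1`
(with the comfortable `C = 14` it would read `6/205 ≈ 0.029`).  Floats are floats: no margin at this or any `t′ ≠ 0` cell is asserted here. -/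

/-- The free-band chemical potential of the granted cell `(δ, t′) = (⅛, −3/10)` (table convention `klMuOfDopingTP`). -/
def muCell : ℝ := klMuOfDopingTP (-3 / 10) (1 / 8)

/-- TARGET v2 (H1 at the cell): Friedel decay amplitude `1/12` beyond range `16` (floats: shell sup-amplitude `max |χ̂₀(R)|·|R|₂² ≤ 0.057` on every
resolved shell `17 ≤ |R|_∞ ≤ 30`, two independent evaluators; beyond `s ≈ 30` no float evidence either way — the research-grade input).
A statement, not a claim. -/
def FriedelDecayV2_d0125_tm03 : Prop := KlFriedelDecayTP (-3 / 10) muCell (1 / 12) 16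

/-- TARGET (H2 at the cell): trace-growth constant `12` (floats: `F(s)/(s+1) ≤ 11.04` for `s ≤ 34` on a `192`-node model; sharp-law asymptote
`≈ 10.3`).  A statement, not a claim. -/
def TraceGrowth_d0125_tm03 : Prop := KlTraceGrowthTP (-3 / 10) muCell 12

/-- TARGET v2 (finite certificate at the cell): at range `R₀ = 40` the truncated `B1g` bottom lies by `1/5` below every other truncated bottom
(floats: truncated gap `0.237`, flat in `R₀` from `R₀ = 8` on).  A statement, not a claim. -/
def TruncatedGapV2_d0125_tm03 : Prop :=
  ∀ χ : D4Irrep, χ ≠ D4Irrep.B1g →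
    truncatedChannelInfTP 40 (-3 / 10) muCell D4Irrep.B1g + 1 / 5 ≤ truncatedChannelInfTP 40 (-3 / 10) muCell χ

/-- **Joint reading of the three v2 targets** (with the analytic tail schema and the side conditions): the granted cell carries the margin
`1/5 − 2·(3·12·(1/12))/41 = 11/205` at `U = 1`.  Pure bookkeeping over §2–§3; it asserts nothing by itself. -/
theorem cellV2_d0125_tm03_of_targets (h1 : FriedelDecayV2_d0125_tm03) (h2 : TraceGrowth_d0125_tm03) (h3 : TruncatedGapV2_d0125_tm03)
    (hT : KlTailFromDecayTP (-3 / 10) muCell)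
    (hS : ∀ χ, {ψ | IsChannelState (squareDispersion 1 (-3 / 10)) muCell χ ψ}.Nonempty)
    (hq : ∀ χ, BddBelow (pairingForm (squareDispersion 1 (-3 / 10)) muCell 1 ''
      {ψ | IsChannelState (squareDispersion 1 (-3 / 10)) muCell χ ψ}))
    (ht : ∀ χ, BddBelow (truncatedPairingFormTP 40 (-3 / 10) muCell ''
      {ψ | IsChannelState (squareDispersion 1 (-3 / 10)) muCell χ ψ})) :
    KLB1gDominatesAtTP (-3 / 10) muCell muCell (11 / 205) := by
  have htail : ∀ χ, KlTailBoundTP 40 (-3 / 10) muCell (3 * 12 * (1 / 12) / ((40 : ℕ) + 1 : ℝ)) χ :=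
    hT (1 / 12) 12 16 40 (by norm_num) (by norm_num) (by norm_num) h1 h2
  refine klB1gDominatesAtTP_of_truncation (τ := fun _ => 3 * 12 * (1 / 12) / ((40 : ℕ) + 1 : ℝ)) hS hq ht htail ?_
  intro χ hχ
  have := h3 χ hχ
  norm_num at this ⊢
  linarith

end Summit.HubbardSuperconductivity.HubbardSuperconductivity.Theorems.KlHarmonicDual

end
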